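import Literature.Analysis.FluidPDE.CylinderInversion
import Literature.Analysis.FluidPDE.LipschitzBiotSavart
import Literature.Analysis.FluidPDE.BallCutoff
import Mathlib.Analysis.Convex.Measure
import Mathlib.Analysis.Calculus.FDeriv.Measurable
import Mathlib.Analysis.Calculus.LocalExtr.Basic
import HarnessLib

/-!
# The velocity glued to its reflection across the wall: a log-Lipschitz bound up to the boundary

Analysis/FluidPDE support file on the discharge path of the named fact
`Literature.Analysis.FluidPDE.ShirotaYanagisawa1993_periodicCylinderLogDivCurlEstimate`
(`Ferrari1993LogEstimateReduction.lean`; Shirota–Yanagisawa 1993, (15) p. 80; Ferrari 1993,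
Cor. 1 (31) p. 286). Fifth file of the plan described in `LogLipschitzKernelBounds.lean`: for a
velocity field `v`, `C¹` on the closed cylinder `{r ≤ 1}`, divergence free in `{r < 1}` and
tangential on `{r = 1}`, the **glued field** `gluedField v` (`= v` on `{r ≤ 1}`,
`= reflectedField v` on `{r > 1}`, `CylinderInversion.lean`) is continuous (the two agree on the
wall), Lipschitz on balls (gluing across the level set `{r = 1}` inside a convex set,
`LipschitzOnWith.of_le_one_of_one_le`), differentiable off the null wall with vorticity bounded by
the vorticity of `v` and divergence bounded by `dist(·, wall) · sup ‖Dv‖`; cutting it off by the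
tree's `ballCutoff x (R/3)` gives a Lipschitz compactly supported field to which the log-Lipschitz
bound `norm_sub_le_of_lipschitz_decomposition` of `LipschitzBiotSavart.lean` applies. Result
(`norm_sub_le_of_glued_reflection`): with `A ≥ sup_{r<1} |curl v|`, `G ≥ sup_{r<1} ‖Dv‖`,
`V ≥ sup_{r≤1} |v|`, a point `x` with `r(x) < 1`, a radius `0 < R ≤ 1/4` and `z` with
`r(z) < 1`, `0 < |x − z| ≤ R/4`,
`‖v(x) − v(z)‖ ≤ K (96 A d (1 + log(R/d)) + 30 G d R + (24 C₀ |B₁| V / R) d / R³)`, `d = |x − z|`,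
with the absolute constants `K = 3K₀/m₀` of `LipschitzBiotSavart.lean` and `C₀` of the cutoff
(`exists_norm_fderiv_ballCutoff_le`). The term in `G` carries the small factor `R` (the
divergence defect of the reflection vanishes linearly at the wall) and the term in `V` will carry
a small factor once `V` is bounded by the energy and `G` (`ShirotaYanagisawaLogDivCurlHolds.lean`),
so that both are absorbed in `sup ‖Dv‖`.

## Mathlib / tree search

Tree (used): `CylinderInversion` (the reflection and its pointwise calculus),
`LipschitzBiotSavart` (`norm_sub_le_of_lipschitz_decomposition`), `ballCutoff` with
`exists_norm_fderiv_ballCutoff_le` (`BallCutoff`), `convex_unitCylinder`, `frontier_unitCylinder`,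
`closure_unitCylinder`, `uniqueDiffOn_closure_unitCylinder`, `closure_unitCylinder_mem_nhds`.
Mathlib (used): `Convex.addHaar_frontier` (the wall is null), `measurable_fderiv`,
`continuous_if`, `intermediate_value_Icc`, `Convex.lipschitzOnWith_of_nnnorm_fderivWithin_le`,
`lipschitzWith_of_nnnorm_fderiv_le`, `IsLocalMin.fderiv_eq_zero`, `HasFDerivAt.smul`,
`Filter.EventuallyEq.fderiv_eq`.

## References

* T. Shirota, T. Yanagisawa, Proc. Japan Acad. 69 (1993) 77–82, proof of (15), p. 81.
  [ShirotaYanagisawa1993]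
* A. B. Ferrari, Comm. Math. Phys. 155 (1993) 277–294, proof of Prop. 1. [Ferrari1993]
-/

noncomputable section

open MeasureTheory Set Function Filter Metric Real WithLp
open _root_.Topology
open scoped NNReal ENNReal RealInnerProductSpace ContDiff

namespace Literature.Analysis.FluidPDE

open NewtonPotentialHolder

/-- Local notation for physical space `ℝ³ = EuclideanSpace ℝ (Fin 3)`. -/
local notation "ℝ³" => EuclideanSpace ℝ (Fin 3)

/-- Local notation for the closed unit cylinder `{r ≤ 1}`. -/
local notation "𝕂" => closure (SetLike.coe unitCylinder : Set (EuclideanSpace ℝ (Fin 3)))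

/-! ### Gluing Lipschitz functions across a level set inside a convex set -/

/-- **Gluing lemma**: inside a convex set `K`, a function which is `L`-Lipschitz on
`K ∩ {g ≤ 1}` and on `K ∩ {1 ≤ g}`, `g` continuous, is `L`-Lipschitz on `K` (a segment from one
piece to the other crosses the level set `{g = 1}`, which lies in both pieces). [folklore] -/
theorem LipschitzOnWith.of_le_one_of_one_le {F : Type*} [PseudoMetricSpace F] {K : Set ℝ³}
    (hK : Convex ℝ K) {g : ℝ³ → ℝ} (hg : Continuous g) {f : ℝ³ → F} {L : ℝ≥0}
    (h₁ : LipschitzOnWith L f (K ∩ {y | g y ≤ 1})) (h₂ : LipschitzOnWith L f (K ∩ {y | 1 ≤ g y})) :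
    LipschitzOnWith L f K := by
  -- the mixed case, for `g a ≤ 1 ≤ g b`
  have key : ∀ a ∈ K, ∀ b ∈ K, g a ≤ 1 → 1 ≤ g b → dist (f a) (f b) ≤ L * dist a b := by
    intro a ha b hb hga hgb
    set γ : ℝ → ℝ³ := fun t => a + t • (b - a) with hγ
    have hγc : Continuous γ := by rw [hγ]; fun_prop
    have hγK : ∀ t ∈ Icc (0 : ℝ) 1, γ t ∈ K := fun t ht => by
      rw [hγ]
      have := hK.add_smul_sub_mem ha hb ht
      simpa using this
    obtain ⟨t₀, ht₀, hgt₀⟩ : ∃ t₀ ∈ Icc (0 : ℝ) 1, g (γ t₀) = 1 := by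
      have h := intermediate_value_Icc (zero_le_one (α := ℝ)) (hg.comp hγc).continuousOn
      have h0 : (g ∘ γ) 0 ≤ 1 := by simpa [hγ] using hga
      have h1 : 1 ≤ (g ∘ γ) 1 := by simpa [hγ] using hgb
      exact h ⟨h0, h1⟩
    set m := γ t₀ with hm
    have hmK : m ∈ K := hγK t₀ ht₀
    have d1 : dist (f a) (f m) ≤ L * dist a m :=
      h₁.dist_le_mul a ⟨ha, hga⟩ m ⟨hmK, by rw [mem_setOf_eq, hgt₀]⟩
    have d2 : dist (f m) (f b) ≤ L * dist m b :=
      h₂.dist_le_mul m ⟨hmK, by rw [mem_setOf_eq, hgt₀]⟩ b ⟨hb, hgb⟩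
    have e1 : dist a m = t₀ * dist a b := by
      rw [hm, hγ, dist_eq_norm, dist_eq_norm, show a - (a + t₀ • (b - a)) = -(t₀ • (b - a)) by abel,
        norm_neg, norm_smul, Real.norm_eq_abs, abs_of_nonneg ht₀.1, norm_sub_rev]
    have e2 : dist m b = (1 - t₀) * dist a b := by
      rw [hm, hγ, dist_eq_norm, dist_eq_norm,
        show a + t₀ • (b - a) - b = -((1 - t₀) • (b - a)) by rw [sub_smul, one_smul]; abel,
        norm_neg, norm_smul, Real.norm_eq_abs, abs_of_nonneg (by linarith [ht₀.2]), norm_sub_rev]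
    calc dist (f a) (f b) ≤ dist (f a) (f m) + dist (f m) (f b) := dist_triangle _ _ _
      _ ≤ L * dist a m + L * dist m b := add_le_add d1 d2
      _ = L * dist a b := by rw [e1, e2]; ring
  refine LipschitzOnWith.of_dist_le_mul fun a ha b hb => ?_
  rcases le_total (g a) 1 with hga | hga <;> rcases le_total (g b) 1 with hgb | hgb
  · exact h₁.dist_le_mul a ⟨ha, hga⟩ b ⟨hb, hgb⟩
  · exact key a ha b hb hga hgb
  · rw [dist_comm (f a), dist_comm a]; exact key b hb a ha hgb hga
  · exact h₂.dist_le_mul a ⟨ha, hga⟩ b ⟨hb, hgb⟩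

/-! ### The glued field -/

/-- **The glued field**: `v` on the closed cylinder `{r ≤ 1}`, the reflected field
`reflectedField v` (`DΦ (v ∘ Φ)`, `Φ` the inversion in the wall) on the exterior `{r > 1}`.
[folklore] -/
def gluedField (v : ℝ³ → ℝ³) (y : ℝ³) : ℝ³ :=
  if cylRadius y ≤ 1 then v y else reflectedField v y

variable {v : ℝ³ → ℝ³}

/-- Inside the closed cylinder the glued field is `v`. [folklore] -/
theorem gluedField_of_le (v : ℝ³ → ℝ³) {y : ℝ³} (hy : cylRadius y ≤ 1) : gluedField v y = v y := by
  rw [gluedField, if_pos hy]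

/-- Outside the closed cylinder the glued field is the reflected field. [folklore] -/
theorem gluedField_of_lt (v : ℝ³ → ℝ³) {y : ℝ³} (hy : 1 < cylRadius y) :
    gluedField v y = reflectedField v y := by
  rw [gluedField, if_neg (not_le.2 hy)]

/-- The glued field agrees with `v` near every interior point. [folklore] -/
theorem gluedField_eventuallyEq_of_lt (v : ℝ³ → ℝ³) {y : ℝ³} (hy : cylRadius y < 1) :
    gluedField v =ᶠ[𝓝 y] v := by
  filter_upwards [(isOpen_lt continuous_cylRadius continuous_const).mem_nhds hy] with w hw
  exact gluedField_of_le v (le_of_lt hw)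

/-- The glued field agrees with the reflected field near every exterior point. [folklore] -/
theorem gluedField_eventuallyEq_of_gt (v : ℝ³ → ℝ³) {y : ℝ³} (hy : 1 < cylRadius y) :
    gluedField v =ᶠ[𝓝 y] reflectedField v := by
  filter_upwards [(isOpen_lt continuous_const continuous_cylRadius).mem_nhds hy] with w hw
  exact gluedField_of_lt v hw

/-- **The glued field is continuous** for `v` continuous on the closed cylinder and tangential on
the wall (the two pieces agree on `{r = 1}`, `reflectedField_eq_of_wall`). [folklore] -/
theorem continuous_gluedField (hv : ContinuousOn v 𝕂)
    (hslip : ∀ x ∈ frontier (unitCylinder : Set ℝ³), ⟪v x, eR x⟫ = 0) :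
    Continuous (gluedField v) := by
  have hfr : frontier {y : ℝ³ | cylRadius y ≤ 1} ⊆ {y | cylRadius y = 1} := by
    exact frontier_le_subset_eq continuous_cylRadius continuous_const
  refine continuous_if (fun y hy => ?_) ?_ ?_
  · have hy1 : cylRadius y = 1 := hfr hy
    exact (reflectedField_eq_of_wall hy1 (hslip y (by rw [frontier_unitCylinder]; exact hy1))).symm
  · have hcl : closure {y : ℝ³ | cylRadius y ≤ 1} = {y | cylRadius y ≤ 1} :=
      (isClosed_le continuous_cylRadius continuous_const).closure_eq
    rw [hcl, ← closure_unitCylinder]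
    exact hv
  · refine (continuousOn_reflectedField hv).mono ?_
    have hcl : closure {y : ℝ³ | ¬cylRadius y ≤ 1} ⊆ {y | 1 ≤ cylRadius y} := by
      have e : {y : ℝ³ | ¬cylRadius y ≤ 1} = {y | 1 < cylRadius y} := by ext y; simp
      rw [e]
      exact closure_lt_subset_le continuous_const continuous_cylRadius
    exact hcl

/-! ### Differentiability off the wall and the pointwise bounds -/

/-- At an interior point the glued field is differentiable with the derivative of `v`.
[folklore] -/
theorem hasFDerivAt_gluedField_of_lt (hv : ContDiffOn ℝ 1 v 𝕂) {y : ℝ³} (hy : cylRadius y < 1) :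
    HasFDerivAt (gluedField v) (fderiv ℝ v y) y := by
  have hyU : y ∈ (unitCylinder : Set ℝ³) := hy
  have hd : DifferentiableAt ℝ v y :=
    (hv.differentiableOn one_ne_zero y (subset_closure hyU)).differentiableAt
      (closure_unitCylinder_mem_nhds hyU)
  exact hd.hasFDerivAt.congr_of_eventuallyEq (gluedField_eventuallyEq_of_lt v hy)

/-- At an exterior point the glued field is differentiable with the derivative of the reflected
field. [folklore] -/
theorem hasFDerivAt_gluedField_of_gt (hv : ContDiffOn ℝ 1 v 𝕂) {y : ℝ³} (hy : 1 < cylRadius y) :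
    HasFDerivAt (gluedField v) (fderiv ℝ (reflectedField v) y) y := by
  have hy0 : cylRadius y ≠ 0 := by linarith
  have hΦ : cylInversion y ∈ (unitCylinder : Set ℝ³) := cylInversion_mem_unitCylinder hy
  have hd : DifferentiableAt ℝ v (cylInversion y) :=
    (hv.differentiableOn one_ne_zero _ (subset_closure hΦ)).differentiableAt
      (closure_unitCylinder_mem_nhds hΦ)
  have h := hasFDerivAt_reflectedField hy0 hd.hasFDerivAt
  exact h.differentiableAt.hasFDerivAt.congr_of_eventuallyEq (gluedField_eventuallyEq_of_gt v hy)

/-- **Vorticity of the glued field, inside**: `|⟨Dw eⱼ, eᵢ⟩ − ⟨Dw eᵢ, eⱼ⟩| ≤ 6 A`. [folklore] -/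
theorem abs_antisymm_fderiv_gluedField_of_lt (hv : ContDiffOn ℝ 1 v 𝕂) {A : ℝ}
    (hA : ∀ p ∈ (unitCylinder : Set ℝ³), ‖curl v p‖ ≤ A) {y : ℝ³} (hy : cylRadius y < 1) (j i : Fin 3) :
    |⟪fderiv ℝ (gluedField v) y (cylBasis j), cylBasis i⟫ -
        ⟪fderiv ℝ (gluedField v) y (cylBasis i), cylBasis j⟫| ≤ 6 * A := by
  rw [(hasFDerivAt_gluedField_of_lt hv hy).fderiv]
  refine (abs_inner_fderiv_sub_le_curl v y _ _).trans ?_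
  rw [norm_cylBasis, norm_cylBasis, mul_one, mul_one]
  exact mul_le_mul_of_nonneg_left (hA y hy) (by norm_num)

/-- **Vorticity of the glued field, outside**: `|⟨Dw eⱼ, eᵢ⟩ − ⟨Dw eᵢ, eⱼ⟩| ≤ 96 A`
(`(1 + 3r⁻²)² ≤ 16` for `r > 1`). [folklore] -/
theorem abs_antisymm_fderiv_gluedField_of_gt (hv : ContDiffOn ℝ 1 v 𝕂) {A : ℝ}
    (hA : ∀ p ∈ (unitCylinder : Set ℝ³), ‖curl v p‖ ≤ A) {y : ℝ³} (hy : 1 < cylRadius y) (j i : Fin 3) :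
    |⟪fderiv ℝ (gluedField v) y (cylBasis j), cylBasis i⟫ -
        ⟪fderiv ℝ (gluedField v) y (cylBasis i), cylBasis j⟫| ≤ 96 * A := by
  have hy0 : cylRadius y ≠ 0 := by linarith
  have hΦ : cylInversion y ∈ (unitCylinder : Set ℝ³) := cylInversion_mem_unitCylinder hy
  have hd : DifferentiableAt ℝ v (cylInversion y) :=
    (hv.differentiableOn one_ne_zero _ (subset_closure hΦ)).differentiableAt
      (closure_unitCylinder_mem_nhds hΦ)
  have hA0 : 0 ≤ A := (norm_nonneg _).trans (hA _ hΦ)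
  rw [(hasFDerivAt_gluedField_of_gt hv hy).fderiv]
  refine (abs_antisymm_fderiv_reflectedField_le hy0 hd j i).trans ?_
  have hq : (cylRadius y ^ 2)⁻¹ ≤ 1 := inv_le_one_of_one_le₀ (by nlinarith)
  have hq0 : 0 ≤ (cylRadius y ^ 2)⁻¹ := by positivity
  calc 6 * ‖curl v (cylInversion y)‖ * (1 + 3 * (cylRadius y ^ 2)⁻¹) ^ 2
      ≤ 6 * A * (1 + 3 * 1) ^ 2 := by gcongr; exact hA _ hΦ
    _ = 96 * A := by ring

/-- **Divergence of the glued field, inside**: `Σᵢ ⟨Dw eᵢ, eᵢ⟩ = 0`. [folklore] -/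
theorem sum_inner_fderiv_gluedField_of_lt (hv : ContDiffOn ℝ 1 v 𝕂)
    (hdiv : ∀ p ∈ (unitCylinder : Set ℝ³), VectorCalculus.divergence v p = 0) {y : ℝ³}
    (hy : cylRadius y < 1) : ∑ i, ⟪fderiv ℝ (gluedField v) y (cylBasis i), cylBasis i⟫ = 0 := by
  rw [(hasFDerivAt_gluedField_of_lt hv hy).fderiv]
  have h := hdiv y hy
  rw [divergence_eq_sum_inner_fderiv (EuclideanSpace.basisFun (Fin 3) ℝ)] at h
  rw [← h]
  refine Finset.sum_congr rfl fun i _ => ?_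
  rw [real_inner_comm]
  simp [cylBasis]

/-- The cylindrical radius is `1`-Lipschitz: `r(y) − r(x) ≤ ‖y − x‖`. [folklore] -/
theorem cylRadius_sub_le_norm_sub (y x : ℝ³) : cylRadius y - cylRadius x ≤ ‖y - x‖ := by
  rw [← norm_horizontalProj, ← norm_horizontalProj]
  calc ‖horizontalProj y‖ - ‖horizontalProj x‖ ≤ ‖horizontalProj y - horizontalProj x‖ := norm_sub_norm_le _ _
    _ = ‖horizontalProj (y - x)‖ := by rw [map_sub]
    _ ≤ ‖y - x‖ := norm_horizontalProj_le _

/-- **Divergence of the glued field, outside**: for `1 < r(y) ≤ 2` and `x` inside,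
`|Σᵢ ⟨Dw eᵢ, eᵢ⟩| ≤ 30 G ‖x − y‖` (`2 · 15 (r − 1) G` and `r(y) − 1 ≤ r(y) − r(x) ≤ ‖y − x‖`).
[folklore] -/
theorem abs_sum_inner_fderiv_gluedField_of_gt (hv : ContDiffOn ℝ 1 v 𝕂)
    (hdiv : ∀ p ∈ (unitCylinder : Set ℝ³), VectorCalculus.divergence v p = 0) {G : ℝ}
    (hG : ∀ p ∈ (unitCylinder : Set ℝ³), ‖fderiv ℝ v p‖ ≤ G) {x y : ℝ³} (hx : cylRadius x < 1)
    (hy : 1 < cylRadius y) (hy2 : cylRadius y ≤ 2) :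
    |∑ i, ⟪fderiv ℝ (gluedField v) y (cylBasis i), cylBasis i⟫| ≤ 30 * G * ‖x - y‖ := by
  have hy0 : cylRadius y ≠ 0 := by linarith
  have hΦ : cylInversion y ∈ (unitCylinder : Set ℝ³) := cylInversion_mem_unitCylinder hy
  have hd : DifferentiableAt ℝ v (cylInversion y) :=
    (hv.differentiableOn one_ne_zero _ (subset_closure hΦ)).differentiableAt
      (closure_unitCylinder_mem_nhds hΦ)
  have hG0 : 0 ≤ G := (norm_nonneg _).trans (hG _ hΦ)
  rw [(hasFDerivAt_gluedField_of_gt hv hy).fderiv]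
  refine (abs_sum_inner_fderiv_reflectedField_le hy0 hd (hdiv _ hΦ)).trans ?_
  have h1 := abs_inv_pow_four_sub_one_le hy.le hy2
  have h2 : cylRadius y - 1 ≤ ‖x - y‖ := by
    have := cylRadius_sub_le_norm_sub y x
    rw [norm_sub_rev] at this
    linarith
  calc 2 * |((cylRadius y ^ 2)⁻¹) ^ 2 - 1| * ‖fderiv ℝ v (cylInversion y)‖
      ≤ 2 * (15 * (cylRadius y - 1)) * G :=
        mul_le_mul (mul_le_mul_of_nonneg_left h1 (by norm_num)) (hG _ hΦ) (norm_nonneg _)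
          (by nlinarith)
    _ ≤ 2 * (15 * ‖x - y‖) * G := by gcongr
    _ = 30 * G * ‖x - y‖ := by ring

/-- **Size of the glued field**: `‖gluedField v y‖ ≤ 4V` for `V ≥ sup_{r≤1} |v|` (inside `≤ V`,
outside `‖DΦ‖ ≤ 1 + 3r⁻² ≤ 4`). [folklore] -/
theorem norm_gluedField_le {V : ℝ} (hV : ∀ p ∈ 𝕂, ‖v p‖ ≤ V) (y : ℝ³) :
    ‖gluedField v y‖ ≤ 4 * V := by
  have hV0 : 0 ≤ V := (norm_nonneg _).trans (hV 0 (subset_closure zero_mem_unitCylinder))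
  by_cases hy : cylRadius y ≤ 1
  · rw [gluedField_of_le v hy]
    have := hV y (by rw [closure_unitCylinder]; exact hy)
    linarith
  · rw [not_le] at hy
    have hy0 : cylRadius y ≠ 0 := by linarith
    rw [gluedField_of_lt v hy, reflectedField_apply]
    refine (norm_fderiv_cylInversion_apply_le hy0 _).trans ?_
    have hq : (cylRadius y ^ 2)⁻¹ ≤ 1 := inv_le_one_of_one_le₀ (by nlinarith)
    have hin : cylInversion y ∈ 𝕂 := cylInversion_mem_closure_unitCylinder hy.le
    calc (1 + 3 * (cylRadius y ^ 2)⁻¹) * ‖v (cylInversion y)‖ ≤ (1 + 3 * 1) * V :=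
          mul_le_mul (by linarith) (hV _ hin) (norm_nonneg _) (by norm_num)
      _ = 4 * V := by norm_num

/-! ### Lipschitz bounds -/

/-- **Lipschitz from `C¹` on a compact convex piece**: a function `C¹` on a convex set `S` with
unique derivatives is Lipschitz on every compact convex `K ⊆ S`. [folklore] -/
theorem exists_lipschitzOnWith_of_contDiffOn {F : Type*} [NormedAddCommGroup F] [NormedSpace ℝ F]
    {f : ℝ³ → F} {S K : Set ℝ³} (hf : ContDiffOn ℝ 1 f S) (hS : UniqueDiffOn ℝ S) (hKS : K ⊆ S)
    (hK : IsCompact K) (hKc : Convex ℝ K) : ∃ L : ℝ≥0, LipschitzOnWith L f K := by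
  have hcont : ContinuousOn (fderivWithin ℝ f S) K := (hf.continuousOn_fderivWithin hS le_rfl).mono hKS
  obtain ⟨B, hB⟩ := hK.exists_bound_of_continuousOn hcont
  refine ⟨Real.toNNReal B, hKc.lipschitzOnWith_of_nnnorm_hasFDerivWithin_le (f' := fderivWithin ℝ f S)
    (fun y hy => ((hf.differentiableOn one_ne_zero y (hKS hy)).hasFDerivWithinAt).mono hKS) fun y hy => ?_⟩
  rw [← NNReal.coe_le_coe, coe_nnnorm, Real.coe_toNNReal']
  exact (hB y hy).trans (le_max_left _ _)

/-- **Lipschitz product rule** for a field of operators applied to a field of vectors, with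
bounds. [folklore] -/
theorem LipschitzOnWith.clm_apply_of_bound {K : Set ℝ³} {S : ℝ³ → ℝ³ →L[ℝ] ℝ³} {V : ℝ³ → ℝ³}
    {LS LV : ℝ≥0} {BS BV : ℝ} (hS : LipschitzOnWith LS S K) (hV : LipschitzOnWith LV V K)
    (bS : ∀ y ∈ K, ‖S y‖ ≤ BS) (bV : ∀ y ∈ K, ‖V y‖ ≤ BV) :
    LipschitzOnWith (Real.toNNReal BS * LV + LS * Real.toNNReal BV) (fun y => S y (V y)) K := by
  refine LipschitzOnWith.of_dist_le_mul fun a ha b hb => ?_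
  have h1 := hS.dist_le_mul a ha b hb
  have h2 := hV.dist_le_mul a ha b hb
  rw [dist_eq_norm] at h1 h2 ⊢
  have hBS : BS ≤ Real.toNNReal BS := Real.le_coe_toNNReal BS
  have hBV : BV ≤ Real.toNNReal BV := Real.le_coe_toNNReal BV
  calc ‖S a (V a) - S b (V b)‖ = ‖S a (V a - V b) + (S a - S b) (V b)‖ := by
        congr 1; simp only [map_sub, sub_apply]; abel
    _ ≤ ‖S a‖ * ‖V a - V b‖ + ‖S a - S b‖ * ‖V b‖ :=
        (norm_add_le _ _).trans (add_le_add (ContinuousLinearMap.le_opNorm _ _) (ContinuousLinearMap.le_opNorm _ _))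
    _ ≤ Real.toNNReal BS * (LV * ‖a - b‖) + LS * ‖a - b‖ * Real.toNNReal BV :=
        add_le_add (mul_le_mul ((bS a ha).trans hBS) h2 (norm_nonneg _) (by positivity))
          (mul_le_mul h1 ((bV b hb).trans hBV) (norm_nonneg _) (by positivity))
    _ = (Real.toNNReal BS * LV + LS * Real.toNNReal BV : ℝ≥0) * ‖a - b‖ := by push_cast; ring

/-- **Lipschitz product rule** for a scalar function times a field, with bounds. [folklore] -/
theorem LipschitzOnWith.smul_of_bound {K : Set ℝ³} {c : ℝ³ → ℝ} {V : ℝ³ → ℝ³}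
    {Lc LV : ℝ≥0} {Bc BV : ℝ} (hc : LipschitzOnWith Lc c K) (hV : LipschitzOnWith LV V K)
    (bc : ∀ y ∈ K, |c y| ≤ Bc) (bV : ∀ y ∈ K, ‖V y‖ ≤ BV) :
    LipschitzOnWith (Real.toNNReal Bc * LV + Lc * Real.toNNReal BV) (fun y => c y • V y) K := by
  refine LipschitzOnWith.of_dist_le_mul fun a ha b hb => ?_
  have h1 := hc.dist_le_mul a ha b hb
  have h2 := hV.dist_le_mul a ha b hb
  rw [dist_eq_norm] at h1 h2 ⊢
  rw [Real.norm_eq_abs] at h1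
  have hBc : Bc ≤ Real.toNNReal Bc := Real.le_coe_toNNReal Bc
  have hBV : BV ≤ Real.toNNReal BV := Real.le_coe_toNNReal BV
  calc ‖c a • V a - c b • V b‖ = ‖c a • (V a - V b) + (c a - c b) • V b‖ := by
        congr 1; rw [smul_sub, sub_smul]; abel
    _ ≤ |c a| * ‖V a - V b‖ + |c a - c b| * ‖V b‖ := by
        refine (norm_add_le _ _).trans (add_le_add ?_ ?_) <;> rw [norm_smul, Real.norm_eq_abs]
    _ ≤ Real.toNNReal Bc * (LV * ‖a - b‖) + Lc * ‖a - b‖ * Real.toNNReal BV :=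
        add_le_add (mul_le_mul ((bc a ha).trans hBc) h2 (norm_nonneg _) (by positivity))
          (mul_le_mul h1 ((bV b hb).trans hBV) (norm_nonneg _) (by positivity))
    _ = (Real.toNNReal Bc * LV + Lc * Real.toNNReal BV : ℝ≥0) * ‖a - b‖ := by push_cast; ring

/-- `v` is Lipschitz on bounded pieces of the closed cylinder. [folklore] -/
theorem exists_lipschitzOnWith_closure (hv : ContDiffOn ℝ 1 v 𝕂) (x : ℝ³) :
    ∃ L : ℝ≥0, LipschitzOnWith L v (𝕂 ∩ closedBall x 1) := by
  have hconv : Convex ℝ (𝕂 : Set ℝ³) := convex_unitCylinder.closure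
  exact exists_lipschitzOnWith_of_contDiffOn hv uniqueDiffOn_closure_unitCylinder inter_subset_left
    ((isCompact_closedBall x 1).inter_left isClosed_closure) (hconv.inter (convex_closedBall x 1))

/-- The inversion and its derivative are `C¹` on the open set `{r ≠ 0}`. [folklore] -/
theorem contDiffOn_cylInversion_and_fderiv :
    ContDiffOn ℝ 1 cylInversion {y : ℝ³ | cylRadius y ≠ 0} ∧
      ContDiffOn ℝ 1 (fderiv ℝ cylInversion) {y : ℝ³ | cylRadius y ≠ 0} :=
  ⟨fun _ hy => (contDiffAt_cylInversion hy).contDiffWithinAt,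
    fun _ hy => ((contDiffAt_cylInversion hy (n := 2)).fderiv_right le_rfl).contDiffWithinAt⟩

/-- **The glued field is Lipschitz on small balls about interior points** (`r(x) < 1`,
`0 < R ≤ 1/4`): near the axis the ball lies in the open cylinder where the glued field is `v`;
otherwise the ball avoids the axis, `v` is Lipschitz on the inner piece, the reflected field
`DΦ (v ∘ Φ)` on the outer piece (products and compositions of Lipschitz maps), and the two are
glued across `{r = 1}` (`LipschitzOnWith.of_le_one_of_one_le`). Only the existence of a constant
matters downstream. [folklore] -/
theorem exists_lipschitzOnWith_gluedField (hv : ContDiffOn ℝ 1 v 𝕂)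
    (hslip : ∀ x ∈ frontier (unitCylinder : Set ℝ³), ⟪v x, eR x⟫ = 0) {x : ℝ³} (hx : cylRadius x < 1)
    {R : ℝ} (hR : 0 < R) (hR4 : R ≤ 1 / 4) :
    ∃ L : ℝ≥0, LipschitzOnWith L (gluedField v) (closedBall x R) := by
  obtain ⟨Lv, hLv⟩ := exists_lipschitzOnWith_closure hv x
  have hKb1 : closedBall x R ⊆ closedBall x 1 := closedBall_subset_closedBall (by linarith)
  have hrad : ∀ y ∈ closedBall x R, cylRadius y ≤ cylRadius x + R ∧ cylRadius x - R ≤ cylRadius y := by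
    intro y hy
    rw [mem_closedBall, dist_eq_norm] at hy
    have h1 := cylRadius_sub_le_norm_sub y x
    have h2 := cylRadius_sub_le_norm_sub x y
    rw [norm_sub_rev] at h2
    constructor <;> linarith
  -- the inner piece
  have hin : LipschitzOnWith Lv (gluedField v) (closedBall x R ∩ {y | cylRadius y ≤ 1}) := by
    refine LipschitzOnWith.of_dist_le_mul fun a ha b hb => ?_
    rw [gluedField_of_le v ha.2, gluedField_of_le v hb.2]
    exact hLv.dist_le_mul a ⟨by rw [closure_unitCylinder]; exact ha.2, hKb1 ha.1⟩
      b ⟨by rw [closure_unitCylinder]; exact hb.2, hKb1 hb.1⟩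
  by_cases hxa : cylRadius x ≤ 1 / 2
  · -- the whole ball is in the open cylinder
    refine ⟨Lv, LipschitzOnWith.of_dist_le_mul fun a ha b hb => ?_⟩
    have ha' : cylRadius a ≤ 1 := by linarith [(hrad a ha).1]
    have hb' : cylRadius b ≤ 1 := by linarith [(hrad b hb).1]
    exact hin.dist_le_mul a ⟨ha, ha'⟩ b ⟨hb, hb'⟩
  · rw [not_le] at hxa
    -- the ball avoids the axis
    have hU : closedBall x R ⊆ {y : ℝ³ | cylRadius y ≠ 0} := fun y hy => by
      rw [mem_setOf_eq]; linarith [(hrad y hy).2]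
    have hUo : IsOpen {y : ℝ³ | cylRadius y ≠ 0} := isOpen_ne_fun continuous_cylRadius continuous_const
    obtain ⟨LΦ, hLΦ⟩ := exists_lipschitzOnWith_of_contDiffOn contDiffOn_cylInversion_and_fderiv.1
      hUo.uniqueDiffOn hU (isCompact_closedBall x R) (convex_closedBall x R)
    obtain ⟨LS, hLS⟩ := exists_lipschitzOnWith_of_contDiffOn contDiffOn_cylInversion_and_fderiv.2
      hUo.uniqueDiffOn hU (isCompact_closedBall x R) (convex_closedBall x R)
    -- the outer piece `K₂`
    set K₂ : Set ℝ³ := closedBall x R ∩ {y | 1 ≤ cylRadius y} with hK₂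
    have hmaps : MapsTo cylInversion K₂ (𝕂 ∩ closedBall x 1) := by
      intro y hy
      refine ⟨cylInversion_mem_closure_unitCylinder hy.2, ?_⟩
      rw [mem_closedBall, dist_eq_norm]
      have hyx : ‖y - x‖ ≤ R := by have := hy.1; rwa [mem_closedBall, dist_eq_norm] at this
      have h1 : cylRadius y - 1 ≤ ‖y - x‖ := by linarith [cylRadius_sub_le_norm_sub y x]
      calc ‖cylInversion y - x‖ ≤ ‖cylInversion y - y‖ + ‖y - x‖ := norm_sub_le_norm_sub_add_norm_sub _ _ _
        _ ≤ 2 * (cylRadius y - 1) + ‖y - x‖ := by gcongr; exact norm_cylInversion_sub_le hy.2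
        _ ≤ 1 := by linarith
    have hV : LipschitzOnWith (Lv * LΦ) (v ∘ cylInversion) K₂ := hLv.comp (hLΦ.mono inter_subset_left) hmaps
    obtain ⟨BV, hBV⟩ : ∃ BV, ∀ p ∈ 𝕂 ∩ closedBall x 1, ‖v p‖ ≤ BV :=
      ((isCompact_closedBall x 1).inter_left isClosed_closure).exists_bound_of_continuousOn
        (hv.continuousOn.mono inter_subset_left)
    have bS : ∀ y ∈ K₂, ‖fderiv ℝ cylInversion y‖ ≤ 4 := fun y hy => by
      have hy0 : cylRadius y ≠ 0 := hU hy.1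
      have hy1 : 1 ≤ cylRadius y := hy.2
      refine (norm_fderiv_cylInversion_le hy0).trans ?_
      have : (cylRadius y ^ 2)⁻¹ ≤ 1 := inv_le_one_of_one_le₀ (by nlinarith)
      linarith
    have bV : ∀ y ∈ K₂, ‖(v ∘ cylInversion) y‖ ≤ BV := fun y hy => hBV _ (hmaps hy)
    have hout' := LipschitzOnWith.clm_apply_of_bound (hLS.mono inter_subset_left) hV bS bV
    -- on `K₂` the glued field is the reflected field
    have hout : LipschitzOnWith (Real.toNNReal 4 * (Lv * LΦ) + LS * Real.toNNReal BV) (gluedField v) K₂ := by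
      refine LipschitzOnWith.of_dist_le_mul fun a ha b hb => ?_
      have heq : ∀ c ∈ K₂, gluedField v c = fderiv ℝ cylInversion c ((v ∘ cylInversion) c) := by
        intro c hc
        rcases (show 1 ≤ cylRadius c from hc.2).lt_or_eq with h | h
        · rw [gluedField_of_lt v h]; rfl
        · rw [gluedField_of_le v h.symm.le]
          have hw := reflectedField_eq_of_wall h.symm (hslip c (by rw [frontier_unitCylinder]; exact h.symm))
          rw [← hw]; rfl
      rw [heq a ha, heq b hb]
      exact hout'.dist_le_mul a ha b hb
    refine ⟨max Lv (Real.toNNReal 4 * (Lv * LΦ) + LS * Real.toNNReal BV),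
      LipschitzOnWith.of_le_one_of_one_le (convex_closedBall x R) continuous_cylRadius
        (hin.weaken (le_max_left _ _)) (hout.weaken (le_max_right _ _))⟩

/-! ### The localised field and its Lipschitz property -/

/-- **The localised glued field** `w = χ · gluedField v`, `χ = ballCutoff x (R/3)` (`= 1` on
`B̄(x, 2R/3)`, `= 0` off `B(x, R)`). [folklore] -/
def locField (v : ℝ³ → ℝ³) (x : ℝ³) (R : ℝ) (y : ℝ³) : ℝ³ :=
  ballCutoff x (R / 3) y • gluedField v y

/-- Unfolding `locField`. [folklore] -/
theorem locField_apply (v : ℝ³ → ℝ³) (x : ℝ³) (R : ℝ) (y : ℝ³) :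
    locField v x R y = ballCutoff x (R / 3) y • gluedField v y := rfl

/-- The cutoff vanishes off `B(x, R)`. [folklore] -/
theorem ballCutoff_third_eq_zero {x : ℝ³} {R : ℝ} (hR : 0 < R) {y : ℝ³} (hy : R ≤ ‖x - y‖) :
    ballCutoff x (R / 3) y = 0 :=
  ballCutoff_eq_zero (by positivity) (by rw [norm_sub_rev]; linarith)

/-- The cutoff is `1` on `B̄(x, 2R/3)`. [folklore] -/
theorem ballCutoff_third_eq_one {x : ℝ³} {R : ℝ} (hR : 0 < R) {y : ℝ³} (hy : ‖x - y‖ ≤ 2 * R / 3) :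
    ballCutoff x (R / 3) y = 1 :=
  ballCutoff_eq_one (by positivity) (by rw [norm_sub_rev]; linarith)

/-- The localised field vanishes off `B(x, R)`. [folklore] -/
theorem locField_eq_zero {x : ℝ³} {R : ℝ} (hR : 0 < R) {y : ℝ³} (hy : R ≤ ‖x - y‖) :
    locField v x R y = 0 := by
  rw [locField_apply, ballCutoff_third_eq_zero hR hy, zero_smul]

/-- The localised field is `v` on `B̄(x, 2R/3) ∩ {r ≤ 1}`. [folklore] -/
theorem locField_eq_of_near {x : ℝ³} {R : ℝ} (hR : 0 < R) {y : ℝ³} (hy : ‖x - y‖ ≤ 2 * R / 3)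
    (hy1 : cylRadius y ≤ 1) : locField v x R y = v y := by
  rw [locField_apply, ballCutoff_third_eq_one hR hy, one_smul, gluedField_of_le v hy1]

/-- The gradient of the cutoff vanishes on `B(x, R/2)` (where `χ ≡ 1`) and off `B(x, R)`
(where `χ` attains its minimum `0`). [folklore] -/
theorem fderiv_ballCutoff_third_eq_zero {x : ℝ³} {R : ℝ} (hR : 0 < R) {y : ℝ³}
    (hy : ‖x - y‖ < R / 2 ∨ R ≤ ‖x - y‖) : fderiv ℝ (ballCutoff x (R / 3)) y = 0 := by
  rcases hy with hy | hy
  · have hmem : y ∈ ball x (2 * (R / 3)) := by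
      rw [mem_ball, dist_eq_norm, norm_sub_rev]; linarith
    rw [(ballCutoff_eventuallyEq_one (by positivity) hmem).fderiv_eq]
    exact fderiv_const_apply 1
  · refine IsLocalMin.fderiv_eq_zero ?_
    refine Filter.Eventually.of_forall fun w => ?_
    rw [ballCutoff_third_eq_zero hR hy]
    exact ballCutoff_nonneg _ _ _

variable {x : ℝ³} {R : ℝ}

/-- **The localised field is Lipschitz** (glued field Lipschitz on the ball, cutoff smooth; glued
with `0` across the sphere `|y − x| = R`). [folklore] -/
theorem exists_lipschitzWith_locField (hv : ContDiffOn ℝ 1 v 𝕂)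
    (hslip : ∀ x ∈ frontier (unitCylinder : Set ℝ³), ⟪v x, eR x⟫ = 0) (hx : cylRadius x < 1)
    (hR : 0 < R) (hR4 : R ≤ 1 / 4) : ∃ L : ℝ≥0, LipschitzWith L (locField v x R) := by
  obtain ⟨Lg, hLg⟩ := exists_lipschitzOnWith_gluedField hv hslip hx hR hR4
  obtain ⟨C₀, -, hC₀⟩ := exists_norm_fderiv_ballCutoff_le
  -- the cutoff is Lipschitz
  have hχd : Differentiable ℝ (ballCutoff x (R / 3)) :=
    (contDiff_ballCutoff x (R / 3) (n := 1)).differentiable (by simp)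
  have hχ : LipschitzWith (Real.toNNReal (C₀ / (R / 3))) (ballCutoff x (R / 3)) := by
    refine lipschitzWith_of_nnnorm_fderiv_le hχd fun y => ?_
    rw [← NNReal.coe_le_coe, coe_nnnorm]
    exact (hC₀ x (R / 3) (by positivity) y).trans (Real.le_coe_toNNReal _)
  -- a bound for the glued field on the ball
  have hcont := continuous_gluedField hv.continuousOn hslip
  obtain ⟨B, hB⟩ := (isCompact_closedBall x R).exists_bound_of_continuousOn hcont.continuousOn
  have hball := LipschitzOnWith.smul_of_bound (hχ.lipschitzOnWith (s := closedBall x R)) hLg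
    (fun y _ => abs_ballCutoff_le_one x (R / 3) y) hB
  set L : ℝ≥0 := Real.toNNReal 1 * Lg + Real.toNNReal (C₀ / (R / 3)) * Real.toNNReal B with hL
  refine ⟨L, lipschitzOnWith_univ.1 ?_⟩
  refine LipschitzOnWith.of_le_one_of_one_le (g := fun y => ‖y - x‖ / R) convex_univ (by fun_prop) ?_ ?_
  · have e : (univ : Set ℝ³) ∩ {y | ‖y - x‖ / R ≤ 1} = closedBall x R := by
      ext y; simp [div_le_one hR, dist_eq_norm]
    rw [e]
    exact hball
  · refine LipschitzOnWith.of_dist_le_mul fun a ha b hb => ?_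
    have ha' : R ≤ ‖x - a‖ := by
      have := ha.2; rw [mem_setOf_eq, one_le_div hR] at this; rwa [norm_sub_rev]
    have hb' : R ≤ ‖x - b‖ := by
      have := hb.2; rw [mem_setOf_eq, one_le_div hR] at this; rwa [norm_sub_rev]
    rw [locField_eq_zero hR ha', locField_eq_zero hR hb', dist_self]
    positivity

/-- The components of the localised field are Lipschitz. [folklore] -/
theorem lipschitzWith_locField_apply {L : ℝ≥0} (h : LipschitzWith L (locField v x R)) (i : Fin 3) :
    LipschitzWith L fun y => locField v x R y i :=
  LipschitzWith.of_dist_le_mul fun a b => by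
    refine le_trans ?_ (h.dist_le_mul a b)
    rw [dist_eq_norm, dist_eq_norm, Real.norm_eq_abs]
    have := PiLp.norm_apply_le (p := 2) (locField v x R a - locField v x R b) i
    rwa [Real.norm_eq_abs] at this

/-- The localised field has compact support (in `B̄(x, R)`). [folklore] -/
theorem hasCompactSupport_locField (hR : 0 < R) : HasCompactSupport (locField v x R) := by
  refine HasCompactSupport.intro (isCompact_closedBall x R) fun y hy => ?_
  rw [mem_closedBall, not_le, dist_eq_norm, norm_sub_rev] at hy
  exact locField_eq_zero hR hy.le

/-! ### The densities of the decomposition -/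

/-- The bounded part of the vorticity of `w`: `χ · (⟨Dŵ eⱼ, eᵢ⟩ − ⟨Dŵ eᵢ, eⱼ⟩)`, `ŵ` the glued
field (set to `0` on the null wall). [folklore] -/
def vortDensity (v : ℝ³ → ℝ³) (x : ℝ³) (R : ℝ) (j i : Fin 3) (y : ℝ³) : ℝ :=
  if cylRadius y = 1 then 0 else ballCutoff x (R / 3) y *
    (⟪fderiv ℝ (gluedField v) y (cylBasis j), cylBasis i⟫ - ⟪fderiv ℝ (gluedField v) y (cylBasis i), cylBasis j⟫)

/-- The linearly vanishing part of the divergence of `w`: `χ · Σᵢ ⟨Dŵ eᵢ, eᵢ⟩` (set to `0` on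
the null wall). [folklore] -/
def divDensity (v : ℝ³ → ℝ³) (x : ℝ³) (R : ℝ) (y : ℝ³) : ℝ :=
  if cylRadius y = 1 then 0 else ballCutoff x (R / 3) y *
    ∑ i, ⟪fderiv ℝ (gluedField v) y (cylBasis i), cylBasis i⟫

/-- The far part of the vorticity of `w`: `∂ⱼχ ŵᵢ − ∂ᵢχ ŵⱼ`. [folklore] -/
def vortFar (v : ℝ³ → ℝ³) (x : ℝ³) (R : ℝ) (j i : Fin 3) (y : ℝ³) : ℝ :=
  fderiv ℝ (ballCutoff x (R / 3)) y (cylBasis j) * gluedField v y i -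
    fderiv ℝ (ballCutoff x (R / 3)) y (cylBasis i) * gluedField v y j

/-- The far part of the divergence of `w`: `Σⱼ ∂ⱼχ ŵⱼ`. [folklore] -/
def divFar (v : ℝ³ → ℝ³) (x : ℝ³) (R : ℝ) (y : ℝ³) : ℝ :=
  ∑ j, fderiv ℝ (ballCutoff x (R / 3)) y (cylBasis j) * gluedField v y j

/-- The glued field is differentiable off the wall. [folklore] -/
theorem hasFDerivAt_gluedField_of_ne (hv : ContDiffOn ℝ 1 v 𝕂) {y : ℝ³} (hy : cylRadius y ≠ 1) :
    HasFDerivAt (gluedField v) (fderiv ℝ (gluedField v) y) y := by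
  rcases lt_or_gt_of_ne hy with h | h
  · exact (hasFDerivAt_gluedField_of_lt hv h).differentiableAt.hasFDerivAt
  · exact (hasFDerivAt_gluedField_of_gt hv h).differentiableAt.hasFDerivAt

/-- **The partial derivatives of the localised field off the wall** (product rule):
`∂ⱼwᵢ = χ ⟨Dŵ eⱼ, eᵢ⟩ + ∂ⱼχ ŵᵢ`. [folklore] -/
theorem lineDeriv_locField_of_ne (hv : ContDiffOn ℝ 1 v 𝕂) {y : ℝ³} (hy : cylRadius y ≠ 1)
    (j i : Fin 3) :
    lineDeriv ℝ (fun y => locField v x R y i) y (cylBasis j) =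
      ballCutoff x (R / 3) y * ⟪fderiv ℝ (gluedField v) y (cylBasis j), cylBasis i⟫ +
        fderiv ℝ (ballCutoff x (R / 3)) y (cylBasis j) * gluedField v y i := by
  have hχ : HasFDerivAt (ballCutoff x (R / 3)) (fderiv ℝ (ballCutoff x (R / 3)) y) y :=
    (((contDiff_ballCutoff x (R / 3) (n := 1)).differentiable (by simp)) y).hasFDerivAt
  have hw : HasFDerivAt (locField v x R)
      (ballCutoff x (R / 3) y • fderiv ℝ (gluedField v) y +
        (fderiv ℝ (ballCutoff x (R / 3)) y).smulRight (gluedField v y)) y :=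
    hχ.smul (hasFDerivAt_gluedField_of_ne hv hy)
  have hwi := (PiLp.proj (𝕜 := ℝ) 2 (fun _ : Fin 3 => ℝ) i).hasFDerivAt.comp y hw
  have e : (fun y => locField v x R y i) = ⇑(PiLp.proj (𝕜 := ℝ) 2 (fun _ : Fin 3 => ℝ) i) ∘ locField v x R := rfl
  rw [e, (hwi.hasLineDerivAt (cylBasis j)).lineDeriv]
  simp [inner_cylBasis_right]

/-! ### The log-Lipschitz bound for `v` up to the wall -/

/-- **Log-Lipschitz bound for the velocity up to the wall.** Let `v` be `C¹` on the closed
cylinder, divergence free in `{r < 1}` and tangential on `{r = 1}`, with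
`|curl v| ≤ A`, `‖Dv‖ ≤ G` on `{r < 1}` and `|v| ≤ V` on `{r ≤ 1}`; let `C₀` be a gradient constant
of the ball cutoff; let `r(x) < 1`, `0 < R ≤ 1/4`, `r(z) < 1` and `0 < |x − z| ≤ R/4`. Then
`‖v(x) − v(z)‖ ≤ K (96 A d (1 + log(R/d)) + 30 G d R + (36 C₀ V |B̄₁| / R) d / R³)`, `d = |x − z|`,
`K = 3K₀/m₀` the constant of `norm_sub_le_of_lipschitz_decomposition` — the decomposition being:
bounded vorticity `χ Ω[Dŵ]` (`≤ 96A`: `abs_antisymm_fderiv_gluedField_of_lt/gt`), linearly vanishing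
divergence `χ tr Dŵ` (`= 0` inside, `≤ 30 G |x − y|` outside, `abs_sum_inner_fderiv_gluedField_of_gt`),
and the cut-off terms (`|∇χ| ≤ 3C₀/R`, `|ŵ| ≤ 4V`) on the shell. [folklore] -/
theorem norm_sub_le_of_glued_reflection (hv : ContDiffOn ℝ 1 v 𝕂)
    (hdiv : ∀ p ∈ (unitCylinder : Set ℝ³), VectorCalculus.divergence v p = 0)
    (hslip : ∀ x ∈ frontier (unitCylinder : Set ℝ³), ⟪v x, eR x⟫ = 0)
    {A G V : ℝ} (hA : ∀ p ∈ (unitCylinder : Set ℝ³), ‖curl v p‖ ≤ A)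
    (hG : ∀ p ∈ (unitCylinder : Set ℝ³), ‖fderiv ℝ v p‖ ≤ G) (hV : ∀ p ∈ 𝕂, ‖v p‖ ≤ V)
    {C₀ : ℝ} (hC₀0 : 0 ≤ C₀)
    (hC₀ : ∀ (c : ℝ³) (r : ℝ), 0 < r → ∀ y : ℝ³, ‖fderiv ℝ (ballCutoff c r) y‖ ≤ C₀ / r)
    (hx : cylRadius x < 1) (hR : 0 < R) (hR4 : R ≤ 1 / 4) {z : ℝ³} (hz : cylRadius z < 1)
    (hxz : x ≠ z) (hd : 4 * ‖x - z‖ ≤ R) :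
    ‖v x - v z‖ ≤
      (3 * (3 * (5 * (4 * π)⁻¹ + 8 / π) * (3 * (volume : Measure ℝ³).real (ball 0 1)) +
          (2 * (4 * π)⁻¹ + 8 / π) * (3 * (volume : Measure ℝ³).real (ball 0 1)) +
          32 * (8 / π)) / ∫ u, regDelta (1 : ℝ) u) *
      (96 * A * ‖x - z‖ * (1 + Real.log (R / ‖x - z‖)) + 30 * G * ‖x - z‖ * R +
        (36 * C₀ * V / R * (volume : Measure ℝ³).real (closedBall 0 1)) * ‖x - z‖ / R ^ 3) := by
  -- nonnegativity of the sizes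
  have hA0 : 0 ≤ A := (norm_nonneg _).trans (hA 0 zero_mem_unitCylinder)
  have hG0 : 0 ≤ G := (norm_nonneg _).trans (hG 0 zero_mem_unitCylinder)
  have hV0 : 0 ≤ V := (norm_nonneg _).trans (hV 0 (subset_closure zero_mem_unitCylinder))
  have hd0 : 0 < ‖x - z‖ := norm_pos_iff.2 (sub_ne_zero.2 hxz)
  -- the localised field and its Lipschitz constant
  obtain ⟨L, hL⟩ := exists_lipschitzWith_locField hv hslip hx hR hR4
  have hwc := hasCompactSupport_locField (v := v) (x := x) hR
  have hcontg := continuous_gluedField hv.continuousOn hslip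
  have hχc : Continuous fun y => fderiv ℝ (ballCutoff x (R / 3)) y :=
    (contDiff_ballCutoff x (R / 3) (n := 1)).continuous_fderiv (by simp)
  -- the wall is null
  have hwall : ∀ᵐ y : ℝ³ ∂volume, cylRadius y ≠ 1 := by
    have h0 : volume (frontier (unitCylinder : Set ℝ³)) = 0 := convex_unitCylinder.addHaar_frontier volume
    rw [frontier_unitCylinder, measure_eq_zero_iff_ae_notMem] at h0
    filter_upwards [h0] with y hy
    simpa using hy
  -- the decomposition a.e.
  have hΩ : ∀ j i, (fun y => lineDeriv ℝ (fun y => locField v x R y i) y (EuclideanSpace.single j (1 : ℝ)) -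
      lineDeriv ℝ (fun y => locField v x R y j) y (EuclideanSpace.single i (1 : ℝ))) =ᵐ[volume]
      fun y => vortDensity v x R j i y + vortFar v x R j i y := by
    intro j i
    filter_upwards [hwall] with y hy
    rw [show EuclideanSpace.single j (1 : ℝ) = cylBasis j from rfl,
      show EuclideanSpace.single i (1 : ℝ) = cylBasis i from rfl,
      lineDeriv_locField_of_ne hv hy, lineDeriv_locField_of_ne hv hy, vortDensity, if_neg hy, vortFar]
    ring
  have hD : (fun y => ∑ j, lineDeriv ℝ (fun y => locField v x R y j) y (EuclideanSpace.single j (1 : ℝ))) =ᵐ[volume]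
      fun y => divDensity v x R y + divFar v x R y := by
    filter_upwards [hwall] with y hy
    simp only [show ∀ j, EuclideanSpace.single j (1 : ℝ) = cylBasis j from fun j => rfl,
      lineDeriv_locField_of_ne hv hy, divDensity, if_neg hy, divFar, Finset.sum_add_distrib, Finset.mul_sum]
  -- measurability of the bounded densities
  have hmeasD : ∀ a b : Fin 3, Measurable fun y => ⟪fderiv ℝ (gluedField v) y (cylBasis a), cylBasis b⟫ :=
    fun a b => (measurable_fderiv_apply_const ℝ (gluedField v) (cylBasis a)).inner_const
  have hχm : Measurable (ballCutoff x (R / 3)) := (contDiff_ballCutoff x (R / 3) (n := 0)).continuous.measurable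
  have hset : MeasurableSet {y : ℝ³ | cylRadius y = 1} :=
    measurableSet_eq_fun continuous_cylRadius.measurable measurable_const
  have hBm : ∀ j i, AEStronglyMeasurable (vortDensity v x R j i) volume := fun j i => by
    refine Measurable.aestronglyMeasurable ?_
    unfold vortDensity
    exact Measurable.ite hset measurable_const (hχm.mul ((hmeasD j i).sub (hmeasD i j)))
  have hEm : AEStronglyMeasurable (divDensity v x R) volume := by
    refine Measurable.aestronglyMeasurable ?_
    unfold divDensity
    exact Measurable.ite hset measurable_const (hχm.mul (Finset.measurable_sum _ fun i _ => hmeasD i i))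
  -- the far terms: continuity, support, integrability, bounds
  have hgi : ∀ i, Continuous fun y => gluedField v y i := fun i =>
    (EuclideanSpace.proj (𝕜 := ℝ) i).continuous.comp hcontg
  have hχj : ∀ j, Continuous fun y => fderiv ℝ (ballCutoff x (R / 3)) y (cylBasis j) := fun j =>
    hχc.clm_apply continuous_const
  have hFvc : ∀ j i, Continuous (vortFar v x R j i) := fun j i => by
    unfold vortFar
    exact ((hχj j).mul (hgi i)).sub ((hχj i).mul (hgi j))
  have hFdc : Continuous (divFar v x R) := by
    unfold divFar
    exact continuous_finsetSum _ fun j _ => (hχj j).mul (hgi j)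
  have hgrad0 : ∀ y, R ≤ ‖x - y‖ → ∀ j, fderiv ℝ (ballCutoff x (R / 3)) y (cylBasis j) = 0 := fun y hy j => by
    rw [fderiv_ballCutoff_third_eq_zero hR (Or.inr hy)]; rfl
  have hgrad0' : ∀ y, ‖x - y‖ < R / 2 → ∀ j, fderiv ℝ (ballCutoff x (R / 3)) y (cylBasis j) = 0 := fun y hy j => by
    rw [fderiv_ballCutoff_third_eq_zero hR (Or.inl hy)]; rfl
  have hFvR : ∀ j i y, R ≤ ‖x - y‖ → vortFar v x R j i y = 0 := fun j i y hy => by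
    simp [vortFar, hgrad0 y hy]
  have hFvn : ∀ j i y, ‖x - y‖ < R / 2 → vortFar v x R j i y = 0 := fun j i y hy => by
    simp [vortFar, hgrad0' y hy]
  have hFdR : ∀ y, R ≤ ‖x - y‖ → divFar v x R y = 0 := fun y hy => by
    simp [divFar, hgrad0 y hy]
  have hFdn : ∀ y, ‖x - y‖ < R / 2 → divFar v x R y = 0 := fun y hy => by
    simp [divFar, hgrad0' y hy]
  have hoff : ∀ y ∉ closedBall x R, R ≤ ‖x - y‖ := fun y hy => by
    rw [mem_closedBall, not_le, dist_eq_norm, norm_sub_rev] at hy; exact hy.le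
  have hFvi : ∀ j i, Integrable (vortFar v x R j i) volume := fun j i =>
    (hFvc j i).integrable_of_hasCompactSupport
      (HasCompactSupport.intro (isCompact_closedBall x R) fun y hy => hFvR j i y (hoff y hy))
  have hFdi : Integrable (divFar v x R) volume :=
    hFdc.integrable_of_hasCompactSupport
      (HasCompactSupport.intro (isCompact_closedBall x R) fun y hy => hFdR y (hoff y hy))
  -- pointwise bounds for the cut-off and the glued field
  have hgradb : ∀ y j, |fderiv ℝ (ballCutoff x (R / 3)) y (cylBasis j)| ≤ 3 * C₀ / R := fun y j => by
    have h := (fderiv ℝ (ballCutoff x (R / 3)) y).le_opNorm (cylBasis j)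
    rw [norm_cylBasis, mul_one, Real.norm_eq_abs] at h
    refine h.trans ((hC₀ x (R / 3) (by positivity) y).trans_eq ?_)
    field_simp
  have hgb : ∀ y i, |gluedField v y i| ≤ 4 * V := fun y i => by
    have h := PiLp.norm_apply_le (p := 2) (gluedField v y) i
    rw [Real.norm_eq_abs] at h
    exact h.trans (norm_gluedField_le hV y)
  have h3C : 0 ≤ 3 * C₀ / R := by positivity
  have hvol : (volume : Measure ℝ³).real (closedBall x R) ≤ (volume : Measure ℝ³).real (closedBall 0 1) := by
    rw [measureReal_def, measureReal_def, ← Measure.addHaar_closedBall_center volume x 1]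
    exact ENNReal.toReal_mono measure_closedBall_lt_top.ne
      (measure_mono (closedBall_subset_closedBall (by linarith)))
  have hint_bound : ∀ F : ℝ³ → ℝ, (∀ y, |F y| ≤ 2 * (3 * C₀ / R) * (4 * V) + (3 * C₀ / R) * (4 * V)) →
      (∀ y, R ≤ ‖x - y‖ → F y = 0) →
      ∫ y, |F y| ≤ 36 * C₀ * V / R * (volume : Measure ℝ³).real (closedBall 0 1) := by
    intro F hF hF0
    have heq : ∫ y, |F y| = ∫ y in closedBall x R, |F y| := by
      refine (setIntegral_eq_integral_of_forall_compl_eq_zero fun y hy => ?_).symm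
      rw [hF0 y (hoff y hy), abs_zero]
    rw [heq]
    have h1 := norm_setIntegral_le_of_norm_le_const (μ := (volume : Measure ℝ³)) (s := closedBall x R)
      measure_closedBall_lt_top
      (fun y _ => show ‖|F y|‖ ≤ 36 * C₀ * V / R from by
        rw [Real.norm_eq_abs, abs_abs]
        refine (hF y).trans_eq ?_
        field_simp
        ring)
    rw [Real.norm_eq_abs, abs_of_nonneg (integral_nonneg fun y => abs_nonneg _)] at h1
    refine h1.trans ?_
    exact mul_le_mul_of_nonneg_left hvol (by positivity)
  have hFvI : ∀ j i, ∫ y, |vortFar v x R j i y| ≤ 36 * C₀ * V / R * (volume : Measure ℝ³).real (closedBall 0 1) := by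
    intro j i
    refine hint_bound _ (fun y => ?_) (hFvR j i)
    unfold vortFar
    calc |fderiv ℝ (ballCutoff x (R / 3)) y (cylBasis j) * gluedField v y i -
          fderiv ℝ (ballCutoff x (R / 3)) y (cylBasis i) * gluedField v y j|
        ≤ |fderiv ℝ (ballCutoff x (R / 3)) y (cylBasis j)| * |gluedField v y i| +
            |fderiv ℝ (ballCutoff x (R / 3)) y (cylBasis i)| * |gluedField v y j| := by
          rw [← abs_mul, ← abs_mul]; exact abs_sub _ _
      _ ≤ (3 * C₀ / R) * (4 * V) + (3 * C₀ / R) * (4 * V) :=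
          add_le_add (mul_le_mul (hgradb y j) (hgb y i) (abs_nonneg _) h3C)
            (mul_le_mul (hgradb y i) (hgb y j) (abs_nonneg _) h3C)
      _ ≤ 2 * (3 * C₀ / R) * (4 * V) + (3 * C₀ / R) * (4 * V) := by nlinarith
  have hFdI : ∫ y, |divFar v x R y| ≤ 36 * C₀ * V / R * (volume : Measure ℝ³).real (closedBall 0 1) := by
    refine hint_bound _ (fun y => ?_) hFdR
    unfold divFar
    calc |∑ j, fderiv ℝ (ballCutoff x (R / 3)) y (cylBasis j) * gluedField v y j|
        ≤ ∑ j, |fderiv ℝ (ballCutoff x (R / 3)) y (cylBasis j) * gluedField v y j| := Finset.abs_sum_le_sum_abs _ _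
      _ ≤ ∑ _j : Fin 3, (3 * C₀ / R) * (4 * V) := Finset.sum_le_sum fun j _ => by
          rw [abs_mul]; exact mul_le_mul (hgradb y j) (hgb y j) (abs_nonneg _) h3C
      _ = 2 * (3 * C₀ / R) * (4 * V) + (3 * C₀ / R) * (4 * V) := by
          rw [Finset.sum_const, Finset.card_univ, Fintype.card_fin, nsmul_eq_mul, Nat.cast_ofNat]; ring
  -- the bounded densities: support and bounds
  have hBR : ∀ j i y, R ≤ ‖x - y‖ → vortDensity v x R j i y = 0 := fun j i y hy => by
    unfold vortDensity
    split_ifs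
    · rfl
    · rw [ballCutoff_third_eq_zero hR hy, zero_mul]
  have hER : ∀ y, R ≤ ‖x - y‖ → divDensity v x R y = 0 := fun y hy => by
    unfold divDensity
    split_ifs
    · rfl
    · rw [ballCutoff_third_eq_zero hR hy, zero_mul]
  have hB : ∀ j i y, |vortDensity v x R j i y| ≤ 96 * A := fun j i y => by
    unfold vortDensity
    split_ifs with h
    · rw [abs_zero]; positivity
    · rw [abs_mul]
      have hχ1 : |ballCutoff x (R / 3) y| ≤ 1 := abs_ballCutoff_le_one _ _ _
      have hin : |⟪fderiv ℝ (gluedField v) y (cylBasis j), cylBasis i⟫ -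
          ⟪fderiv ℝ (gluedField v) y (cylBasis i), cylBasis j⟫| ≤ 96 * A := by
        rcases lt_or_gt_of_ne h with hlt | hgt
        · exact (abs_antisymm_fderiv_gluedField_of_lt hv hA hlt j i).trans (by nlinarith)
        · exact abs_antisymm_fderiv_gluedField_of_gt hv hA hgt j i
      calc |ballCutoff x (R / 3) y| * |⟪fderiv ℝ (gluedField v) y (cylBasis j), cylBasis i⟫ -
            ⟪fderiv ℝ (gluedField v) y (cylBasis i), cylBasis j⟫| ≤ 1 * (96 * A) :=
            mul_le_mul hχ1 hin (abs_nonneg _) zero_le_one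
        _ = 96 * A := one_mul _
  have hE : ∀ y, |divDensity v x R y| ≤ 30 * G * ‖x - y‖ := fun y => by
    unfold divDensity
    split_ifs with h
    · rw [abs_zero]; positivity
    · rcases lt_or_gt_of_ne h with hlt | hgt
      · rw [sum_inner_fderiv_gluedField_of_lt hv hdiv hlt, mul_zero, abs_zero]; positivity
      · by_cases hχ0 : ballCutoff x (R / 3) y = 0
        · rw [hχ0, zero_mul, abs_zero]; positivity
        · have hyR : ‖x - y‖ < R := by
            by_contra hcon
            exact hχ0 (ballCutoff_third_eq_zero hR (not_lt.1 hcon))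
          have hy2 : cylRadius y ≤ 2 := by
            have := cylRadius_sub_le_norm_sub y x
            rw [norm_sub_rev] at this
            linarith
          rw [abs_mul]
          calc |ballCutoff x (R / 3) y| * |∑ i, ⟪fderiv ℝ (gluedField v) y (cylBasis i), cylBasis i⟫|
              ≤ 1 * (30 * G * ‖x - y‖) :=
                mul_le_mul (abs_ballCutoff_le_one _ _ _)
                  (abs_sum_inner_fderiv_gluedField_of_gt hv hdiv hG hx hgt hy2) (abs_nonneg _) zero_le_one
            _ = 30 * G * ‖x - y‖ := one_mul _
  -- the log-Lipschitz bound for the localised field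
  have key := norm_sub_le_of_lipschitz_decomposition (fun i => lipschitzWith_locField_apply hL i) hwc hxz hd
    hBm hEm hFvi hFdi hΩ hD (by positivity : (0 : ℝ) ≤ 96 * A) (by positivity : (0 : ℝ) ≤ 30 * G)
    (by positivity : (0 : ℝ) ≤ 36 * C₀ * V / R * (volume : Measure ℝ³).real (closedBall 0 1))
    hB hBR hE hER hFvn hFvR hFvI hFdn hFdR hFdI
  -- `w x = v x`, `w z = v z`
  have hwx : locField v x R x = v x :=
    locField_eq_of_near hR (by rw [sub_self, norm_zero]; positivity) hx.le
  have hwz : locField v x R z = v z :=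
    locField_eq_of_near hR (by linarith) hz.le
  rw [hwx, hwz] at key
  exact key

end Literature.Analysis.FluidPDE
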